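import Summits.BirchSwinnertonDyer.BirchSwinnertonDyer.Theorems.ByReductionTypeAtTwoSupersingularFlatKummerInjection
import Summits.BirchSwinnertonDyer.BirchSwinnertonDyer.Theorems.ByReductionTypeAtTwoSupersingularFlatKernelCyclicHondaOfQuotientDual
import Summits.BirchSwinnertonDyer.BirchSwinnertonDyer.Theorems.ByReductionTypeAtTwoSupersingularFlatColemanNonzeroAtTwo
import HarnessLib

/-!
# Route `ByReductionTypeAtTwo` (rung K4), crux `SupersingularRankZeroAtTwo` (item stmt-BirchSwinnertonDyer-19097), line `odd_blind_package`
# v2.13 (04fc80b988a3bb5c), stub 5 `stub_flatKernelCyclic : FlatKernelCyclicHondaAtTwo` (hand h13): **h13 VERBATIM MODULO THE ONE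
# DISPLAYED INPUT K86 `H¹_Iw(ℚ₂, T₂E) ≅ Λ²`** — `hcyc` («`Hom(Sel_∞ ⧸ Sel♭, ℚ/ℤ)` is Λ-cyclic», the hypothesis of p824707) for every datum of
# the stub from `e : H¹_Iw ≃ₗ[Λ] Λ²` (h13a = LEAD ★★ p824030 ∘ h13b = `…FlatKummerInjection`), hence from the K86 body, hence
# `flatKernelCyclic_honda_two_of_h1IwFree (hK : ‹K86›) : ‹FlatKernelCyclicHondaAtTwo›` (cell `bsd-2adic`, seat `bsd-2adic-t42` GEN 45;
# `--supports 19097`, helper)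

HONEST FRAMING (D-0036/D-0054): THEOREMS ONLY (no definition, no named fact, no `sorry`, no instance).  `stub_flatKernelCyclic` is NOT
closed: the remaining displayed input is K86 `D86.H1IwPointsModelFreeAtTwo` (its BODY is copied byte-for-byte as the binder `hK`; the
Cruxes module is not imported) — the `Λ`-freeness of rank two of Sprung's points model of `H¹_Iw(ℚ₂, T₂E)` (Greenberg 1989 §3 Cor. 2 ∘
Coates–Greenberg 1996 Props. 4.3/4.8 ∘ `E(ℚ_∞·ℚ₂)[2] = 0`; -imc D-imc-86, T-86 types it).  Everything else of h13 — h13a(ii)(iii) (LEAD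
p823375/p823932/p824030), h13b = K1 p824966 · K2 p824988 · K3 p825063 · K4 p825638/p825693 · K5 + assembly (`…FlatKummerInjection`) — is
KERNEL.  What this is NOT: h13 closed only MODULO K86; NF♭_H = slot 4 needs h11 too (p823354 mod (hCT)(hKR)); CDC_H closed in kernel
UNCONDITIONALLY; (P₋₂′) not in print; 19097 OPEN on 7 stubs (v2.13); nothing booked (D-0054); BSD is proved for no curve; typed ≠ proved.

* `cyclic_quotientDual_sharpFlat_two_of_linearEquiv (e)` — `hcyc` for ONE datum of the stub from `e` (the Honda clause is idle).
* `cyclic_quotientDual_sharpFlat_two_of_h1IwFree (hK)` — the `hcyc` FAMILY of p824707 (binders through the Honda clause, VERBATIM) from K86.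
* ★ `flatKernelCyclic_honda_two_of_h1IwFree (hK) : ‹FlatKernelCyclicHondaAtTwo VERBATIM›` — by p824707.

References: [KitajimaOtsuki2018] (4.2), Prop. 3.29, Prop. 3.32 (arXiv:1607.03612 pp. 16, 19); [Sprung2012] Def. 7.9, 7.11, proof of Prop. 7.3;
[Greenberg1989] §3 Cor. 2; [CoatesGreenberg1996] Props. 4.3, 4.8; tree p824030, p824707, `…FlatKummerInjection`, `Cruxes/…/D86H1IwFreeAtTwo.lean` (K86 text).
-/

set_option autoImplicit false
-- the Theorems namespace of this sub repeats the summit name by design (D-0017 nested layout)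
set_option linter.dupNamespace false

noncomputable section

open scoped Classical NumberField
open NumberField IsDedekindDomain WeierstrassCurve Literature.NumberTheory.EllipticCurves
  Literature.NumberTheory.EllipticCurves.Sprung2017 Literature.NumberTheory.EllipticCurves.Sprung2012
  Literature.NumberTheory.EllipticCurves.Rank1Residual Literature.NumberTheory.EllipticCurves.Rank1Residual.Typed
  Literature.NumberTheory.EllipticCurves.Kobayashi2003 Literature.NumberTheory.EllipticCurves.IwasawaDual
  Literature.NumberTheory.GaloisRepresentations
  ZpExtension Summit.BirchSwinnertonDyer.Rank1Residual Summit.BirchSwinnertonDyer.Rank1Residual.Supersingular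

namespace Summit.BirchSwinnertonDyer.BirchSwinnertonDyer.Theorems.OddBlindNF

/-- **`hcyc` at `p = 2` for ONE datum, from `e : H¹_Iw(ℚ₂, T₂E) ≃ₗ[Λ] Λ²`.**  For `W/ℚ` good supersingular at `2`, `κ` with normalised
generator `γ`, `v ∋ 2`, a local lift `g` and levels `c` with the registry's clauses `hc`, `htr`, `hz`, `hsat`: GIVEN `e`, the `Λ`-module
`Hom(Sel_{2^∞}(E/ℚ_∞) ⧸ Sel♭(E/ℚ_∞), ℚ/ℤ)` is cyclic — h13a (`Ker Col♭ = Λ ∙ z♭`, LEAD p824030) fed into h13b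
(`exists_cyclic_quotientDual_of_colemanKer_eq_span`).  No Honda clause needed. [cite: KitajimaOtsuki2018, (4.2), Prop. 3.29 and Prop. 3.32 (arXiv:1607.03612 pp. 16, 19)]
[cite: Sprung2012, Def. 7.9 and Def. 7.11 (p. 1503)] -/
theorem cyclic_quotientDual_sharpFlat_two_of_linearEquiv (W : WeierstrassCurve ℚ) [W.IsElliptic] [W.IsGloballyMinimal]
    (hss : GoodSS W 2) (κ : ZpExtension ℚ 2) {γ : Field.absoluteGaloisGroup ℚ} (hγ : κ.IsTopGenerator γ)
    {v : HeightOneSpectrum (𝓞 ℚ)} (hv : (2 : 𝓞 ℚ) ∈ v.asIdeal)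
    {g : Field.absoluteGaloisGroup (v.adicCompletion ℚ)} {c : ℕ → localPoints W (v.adicCompletion ℚ)}
    (hg : κ.IsTopGenerator (resGalOfEmb (closureEmb (K := ℚ) (v.adicCompletion ℚ)) g))
    (hc : ∀ n, c n ∈ localLayerPointsOfEmb κ (closureEmb (K := ℚ) (v.adicCompletion ℚ)) W n)
    (htr : ∀ n, 1 ≤ n → localTraceOfEmb κ (closureEmb (K := ℚ) (v.adicCompletion ℚ)) W n (n + 1)
      (c (n + 1)) = W.frobeniusTrace 2 • c n - c (n - 1))
    (hz : ∀ z₀ : localLayerPointsOfEmb κ (closureEmb (K := ℚ) (v.adicCompletion ℚ)) W 0 →+ ℤ_[2],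
      evalOn W (localLayerPointsOfEmb κ (closureEmb (K := ℚ) (v.adicCompletion ℚ)) W 0) z₀ (c 0) = 0 → z₀ = 0)
    (hsat : ∀ a : ℤ_[2],
      (∃ z₀ : localLayerPointsOfEmb κ (closureEmb (K := ℚ) (v.adicCompletion ℚ)) W 0 →+ ℤ_[2],
        evalOn W (localLayerPointsOfEmb κ (closureEmb (K := ℚ) (v.adicCompletion ℚ)) W 0) z₀ (c 0) = 2 * a) →
      ∃ y : localLayerPointsOfEmb κ (closureEmb (K := ℚ) (v.adicCompletion ℚ)) W 0 →+ ℤ_[2],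
        evalOn W (localLayerPointsOfEmb κ (closureEmb (K := ℚ) (v.adicCompletion ℚ)) W 0) y (c 0) = a)
    (e : letI := moduleOfGenerator κ (closureEmb (K := ℚ) (v.adicCompletion ℚ)) W hg
      (localTowerPointsOfEmb κ (closureEmb (K := ℚ) (v.adicCompletion ℚ)) W →+ ℤ_[2]) ≃ₗ[IwasawaAlgebra 2]
        (Fin 2 → IwasawaAlgebra 2)) :
    letI := (isLocNil_quotient_sharpFlat (W := W) (κ := κ) (ι := closureEmb (K := ℚ) (v.adicCompletion ℚ))
      (ap := W.frobeniusTrace 2) (g := g) (c := c) (col := .flat) γ).module (A := AddCircle (1 : ℚ));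
    ∃ y₀ : W.selmerInfty κ ⧸ (sharpFlatSelmerInfty W κ (closureEmb (K := ℚ) (v.adicCompletion ℚ)) (W.frobeniusTrace 2) g c
        .flat).addSubgroupOf (W.selmerInfty κ) →+ AddCircle (1 : ℚ),
      ∀ y, ∃ f : IwasawaAlgebra 2, f • y₀ = y :=
  exists_cyclic_quotientDual_of_colemanKer_eq_span W κ hγ v hg (W.frobeniusTrace 2) c .flat
    (exists_colemanKer_flat_eq_span_of_linearEquiv_fin_two_rat W hss κ hv hg hc htr hz hsat e)

/-- **The `hcyc` family of p824707 (its hypothesis, binders through the Honda clause VERBATIM) from K86.**  The K86 body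
(`Cruxes/SupersingularRankZeroAtTwo/D86H1IwFreeAtTwo.lean`, `D86.H1IwPointsModelFreeAtTwo`, copied byte-for-byte as the binder `hK`)
supplies `e` for every `(W, κ, v, g)`; the Honda clause and `IsCyclotomic`/`IsCyclotomicVariable` are idle.
[cite: Greenberg1989, §3 Corollary 2 (Adv. Stud. Pure Math. 17, p. 112)] [cite: KitajimaOtsuki2018, Prop. 3.29 and Prop. 3.32 (arXiv:1607.03612 p. 16)] -/
theorem cyclic_quotientDual_sharpFlat_two_of_h1IwFree
    (hK :
      ∀ (W : WeierstrassCurve ℚ) [W.IsElliptic] [W.IsGloballyMinimal], GoodSS W 2 →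
        ∀ (κ : ZpExtension ℚ 2) (v : HeightOneSpectrum (𝓞 ℚ)), (2 : 𝓞 ℚ) ∈ v.asIdeal →
          ∀ (g : Field.absoluteGaloisGroup (v.adicCompletion ℚ))
            (hg : κ.IsTopGenerator (resGalOfEmb (closureEmb (K := ℚ) (v.adicCompletion ℚ)) g)),
            Nonempty (letI := moduleOfGenerator κ (closureEmb (K := ℚ) (v.adicCompletion ℚ)) W hg
              (localTowerPointsOfEmb κ (closureEmb (K := ℚ) (v.adicCompletion ℚ)) W →+ ℤ_[2]) ≃ₗ[IwasawaAlgebra 2]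
                (Fin 2 → IwasawaAlgebra 2))) :
    ∀ (W : WeierstrassCurve ℚ) [W.IsElliptic] [W.IsGloballyMinimal], GoodSS W 2 →
      ∀ (κ : ZpExtension ℚ 2) (γ : Field.absoluteGaloisGroup ℚ),
        κ.IsCyclotomic → κ.IsTopGenerator γ → IsCyclotomicVariable 2 γ →
      ∀ (v : HeightOneSpectrum (𝓞 ℚ)), (2 : 𝓞 ℚ) ∈ v.asIdeal →
      ∀ (g : Field.absoluteGaloisGroup (v.adicCompletion ℚ)) (c : ℕ → localPoints W (v.adicCompletion ℚ)),
        κ.IsTopGenerator (resGalOfEmb (closureEmb (K := ℚ) (v.adicCompletion ℚ)) g) →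
        (∀ n, c n ∈ localLayerPointsOfEmb κ (closureEmb (K := ℚ) (v.adicCompletion ℚ)) W n) →
        (∀ n, 1 ≤ n → localTraceOfEmb κ (closureEmb (K := ℚ) (v.adicCompletion ℚ)) W n (n + 1)
          (c (n + 1)) = W.frobeniusTrace 2 • c n - c (n - 1)) →
        (∀ z₀ : localLayerPointsOfEmb κ (closureEmb (K := ℚ) (v.adicCompletion ℚ)) W 0 →+ ℤ_[2],
          evalOn W (localLayerPointsOfEmb κ (closureEmb (K := ℚ) (v.adicCompletion ℚ)) W 0) z₀ (c 0) = 0 → z₀ = 0) →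
        (∀ a : ℤ_[2],
          (∃ z₀ : localLayerPointsOfEmb κ (closureEmb (K := ℚ) (v.adicCompletion ℚ)) W 0 →+ ℤ_[2],
            evalOn W (localLayerPointsOfEmb κ (closureEmb (K := ℚ) (v.adicCompletion ℚ)) W 0) z₀ (c 0) = 2 * a) →
          ∃ y : localLayerPointsOfEmb κ (closureEmb (K := ℚ) (v.adicCompletion ℚ)) W 0 →+ ℤ_[2],
            evalOn W (localLayerPointsOfEmb κ (closureEmb (K := ℚ) (v.adicCompletion ℚ)) W 0) y (c 0) = a) →
        (∃ cneg : localPoints W (v.adicCompletion ℚ),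
          Summit.BirchSwinnertonDyer.Rank1Residual.F1Sign2.IsHondaSystemAtTwo κ (closureEmb (K := ℚ) (v.adicCompletion ℚ)) W
            (W.frobeniusTrace 2) g cneg c) →
      letI := (isLocNil_quotient_sharpFlat (W := W) (κ := κ) (ι := closureEmb (K := ℚ) (v.adicCompletion ℚ))
        (ap := W.frobeniusTrace 2) (g := g) (c := c) (col := .flat) γ).module (A := AddCircle (1 : ℚ));
      ∃ y₀ : W.selmerInfty κ ⧸ (sharpFlatSelmerInfty W κ (closureEmb (K := ℚ) (v.adicCompletion ℚ)) (W.frobeniusTrace 2) g c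
          .flat).addSubgroupOf (W.selmerInfty κ) →+ AddCircle (1 : ℚ),
        ∀ y, ∃ f : IwasawaAlgebra 2, f • y₀ = y := by
  intro W _ _ hss κ γ _ hγ _ v hv g c hg hc htr hz hsat _
  obtain ⟨e⟩ := hK W hss κ v hv g hg
  exact cyclic_quotientDual_sharpFlat_two_of_linearEquiv W hss κ hγ hv hg hc htr hz hsat e

/-- ★ **h13 `FlatKernelCyclicHondaAtTwo` (v2.13 stub 5, signature VERBATIM) MODULO K86 ALONE**: under the K86 body
`H1IwPointsModelFreeAtTwo` (binder `hK`, text of `Cruxes/…/D86H1IwFreeAtTwo.lean` :75–83), the kernel of every pinned `π : X ↠ X♭` is cyclic —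
p824707 `flatKernelCyclic_honda_two_of_cyclic_quotientDual` fed by `cyclic_quotientDual_sharpFlat_two_of_h1IwFree`.  When K86 lands as a
Theorems theorem the by-name discharge `flatKernelCyclic_honda_two` is a one-liner.  CONDITIONAL on K86 (print ∘ kernel, T-86); 19097 OPEN;
BSD proved for no curve. [cite: KitajimaOtsuki2018, (4.2) and Prop. 3.32 (arXiv:1607.03612 pp. 16, 19)] [cite: Sprung2012, Def. 7.9, Def. 7.11]
[cite: Greenberg1989, §3 Corollary 2 (Adv. Stud. Pure Math. 17, p. 112)] -/
theorem flatKernelCyclic_honda_two_of_h1IwFree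
    (hK :
      ∀ (W : WeierstrassCurve ℚ) [W.IsElliptic] [W.IsGloballyMinimal], GoodSS W 2 →
        ∀ (κ : ZpExtension ℚ 2) (v : HeightOneSpectrum (𝓞 ℚ)), (2 : 𝓞 ℚ) ∈ v.asIdeal →
          ∀ (g : Field.absoluteGaloisGroup (v.adicCompletion ℚ))
            (hg : κ.IsTopGenerator (resGalOfEmb (closureEmb (K := ℚ) (v.adicCompletion ℚ)) g)),
            Nonempty (letI := moduleOfGenerator κ (closureEmb (K := ℚ) (v.adicCompletion ℚ)) W hg
              (localTowerPointsOfEmb κ (closureEmb (K := ℚ) (v.adicCompletion ℚ)) W →+ ℤ_[2]) ≃ₗ[IwasawaAlgebra 2]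
                (Fin 2 → IwasawaAlgebra 2))) :
    ∀ (W : WeierstrassCurve ℚ) [W.IsElliptic] [W.IsGloballyMinimal], GoodSS W 2 →
      ∀ (κ : ZpExtension ℚ 2) (γ : Field.absoluteGaloisGroup ℚ),
        κ.IsCyclotomic → κ.IsTopGenerator γ → IsCyclotomicVariable 2 γ →
      ∀ (v : HeightOneSpectrum (𝓞 ℚ)), (2 : 𝓞 ℚ) ∈ v.asIdeal →
      ∀ (g : Field.absoluteGaloisGroup (v.adicCompletion ℚ)) (c : ℕ → localPoints W (v.adicCompletion ℚ)),
        κ.IsTopGenerator (resGalOfEmb (closureEmb (K := ℚ) (v.adicCompletion ℚ)) g) →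
        (∀ n, c n ∈ localLayerPointsOfEmb κ (closureEmb (K := ℚ) (v.adicCompletion ℚ)) W n) →
        (∀ n, 1 ≤ n → localTraceOfEmb κ (closureEmb (K := ℚ) (v.adicCompletion ℚ)) W n (n + 1)
          (c (n + 1)) = W.frobeniusTrace 2 • c n - c (n - 1)) →
        (∀ z₀ : localLayerPointsOfEmb κ (closureEmb (K := ℚ) (v.adicCompletion ℚ)) W 0 →+ ℤ_[2],
          evalOn W (localLayerPointsOfEmb κ (closureEmb (K := ℚ) (v.adicCompletion ℚ)) W 0) z₀ (c 0) = 0 → z₀ = 0) →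
        (∀ a : ℤ_[2],
          (∃ z₀ : localLayerPointsOfEmb κ (closureEmb (K := ℚ) (v.adicCompletion ℚ)) W 0 →+ ℤ_[2],
            evalOn W (localLayerPointsOfEmb κ (closureEmb (K := ℚ) (v.adicCompletion ℚ)) W 0) z₀ (c 0) = 2 * a) →
          ∃ y : localLayerPointsOfEmb κ (closureEmb (K := ℚ) (v.adicCompletion ℚ)) W 0 →+ ℤ_[2],
            evalOn W (localLayerPointsOfEmb κ (closureEmb (K := ℚ) (v.adicCompletion ℚ)) W 0) y (c 0) = a) →
        (∃ cneg : localPoints W (v.adicCompletion ℚ),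
          Summit.BirchSwinnertonDyer.Rank1Residual.F1Sign2.IsHondaSystemAtTwo κ (closureEmb (K := ℚ) (v.adicCompletion ℚ)) W
            (W.frobeniusTrace 2) g cneg c) →
      ∀ (D : SharpFlatSelmerDualData W κ γ (closureEmb (K := ℚ) (v.adicCompletion ℚ))
          (W.frobeniusTrace 2) g c .flat) [Module.Finite (IwasawaAlgebra 2) D.X],
        Module.IsTorsion (IwasawaAlgebra 2) D.X →
      ∀ (S : W.SelmerDualData κ γ) [Module.Finite (IwasawaAlgebra 2) S.X]
        (π : S.X →ₗ[IwasawaAlgebra 2] D.X),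
        (∀ (x : S.X) (s : sharpFlatSelmerInfty W κ (closureEmb (K := ℚ) (v.adicCompletion ℚ)) (W.frobeniusTrace 2) g c .flat),
          D.toDual (π x) s = S.toDual x (AddSubgroup.inclusion
            (sharpFlatSelmerInfty_le_selmerInfty W κ (closureEmb (K := ℚ) (v.adicCompletion ℚ)) (W.frobeniusTrace 2) g c .flat) s)) →
        ∃ x₀ : S.X, LinearMap.ker π = Submodule.span (IwasawaAlgebra 2) {x₀} :=
  flatKernelCyclic_honda_two_of_cyclic_quotientDual (cyclic_quotientDual_sharpFlat_two_of_h1IwFree hK)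

end Summit.BirchSwinnertonDyer.BirchSwinnertonDyer.Theorems.OddBlindNF

end
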